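import Literature.Analysis.FluidPDE.ElgindiStripIterates
import Literature.Analysis.FluidPDE.ElgindiOperatorLocality
import Literature.Analysis.FluidPDE.ElgindiAngularEquationLink
import HarnessLib

/-!
# Classes of functions on the strip extending continuously to `θ = 0` with their `θ`-derivatives
([Elgindi2021] §7.1: regularity of the `L²` solution up to the boundary)

Topic `Literature/Analysis/FluidPDE`. Support file (definitions with bodies and proved theorems, no
named facts) on the proof path of the named fact
`Literature.Analysis.FluidPDE.Elgindi.ElgindiGhoulMasmoudi2021_stabilityCore`
(`ElgindiStabilityDecomposition.lean`). T. M. Elgindi, Ann. of Math. 194 (2021) =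
arXiv:1904.04795, §7.1 Proposition 7.1 (p. 19 of the held text).

Bookkeeping for the boundary bootstrap at `θ = 0`. For `g : ℝ → ℝ → ℝ` let `bext g` be `g` on
`θ > 0` and the one-sided limit `g(R,0⁺)` on `θ ≤ 0`. `ExtZero c g` says that `bext g` is jointly
continuous on the slab `(0,∞) × [0,c)`; `ExtZeroUpTo c m g` says the same for all `∂_θ^l g`,
`l ≤ m`. These classes depend only on the values of `g` on the open strip, are stable under sums,
scalar multiples and multiplication by coefficients continuous on the slab (with all their
`θ`-derivatives), and `ExtZeroUpTo c (m+1) g ↔ ExtZero c g ∧ ExtZeroUpTo c m (∂_θg)`.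
-/

noncomputable section

open MeasureTheory Set Real Filter Function
open _root_.Topology
open scoped ContDiff

namespace Literature.Analysis.FluidPDE

namespace Elgindi

/-! ### The boundary extension and the classes -/

/-- The extension of `g` to `θ ≤ 0` by its one-sided limit `g(R,0⁺)`. [folklore] -/
def bext (g : ℝ → ℝ → ℝ) (p : ℝ × ℝ) : ℝ := if p.2 ≤ 0 then limUnder (𝓝[>] (0:ℝ)) (fun θ => g p.1 θ) else g p.1 p.2

/-- `g` extends jointly continuously to `θ = 0` on the slab `(0,∞) × [0,c)`. [folklore] -/
def ExtZero (c : ℝ) (g : ℝ → ℝ → ℝ) : Prop := ContinuousOn (bext g) (Ioi 0 ×ˢ Ico 0 c)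

/-- All `∂_θ^l g`, `l ≤ m`, extend jointly continuously to `θ = 0`. [folklore] -/
def ExtZeroUpTo (c : ℝ) (m : ℕ) (g : ℝ → ℝ → ℝ) : Prop := ∀ l ≤ m, ExtZero c (dθ^[l] g)

variable {c : ℝ}

/-- On `θ > 0` the extension is `g`. [folklore] -/
theorem bext_of_pos (g : ℝ → ℝ → ℝ) {p : ℝ × ℝ} (hp : 0 < p.2) : bext g p = g p.1 p.2 := by
  simp [bext, not_le.2 hp]

/-- On `θ = 0` the extension is the one-sided limit. [folklore] -/
theorem bext_zero (g : ℝ → ℝ → ℝ) (R : ℝ) : bext g (R, 0) = limUnder (𝓝[>] (0:ℝ)) (fun θ => g R θ) := by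
  simp [bext]

/-- **The extension realises the limit**: if `ExtZero c g` then `g(R,·) → bext g (R,0)` as
`θ → 0⁺`, for every `R > 0`. [folklore] -/
theorem ExtZero.tendsto (hc : 0 < c) {g : ℝ → ℝ → ℝ} (hg : ExtZero c g) {R : ℝ} (hR : 0 < R) :
    Tendsto (fun θ => g R θ) (𝓝[>] 0) (𝓝 (bext g (R, 0))) := by
  have hp : ((R, (0:ℝ)) : ℝ × ℝ) ∈ Ioi 0 ×ˢ Ico 0 c := ⟨hR, left_mem_Ico.2 hc⟩
  have h1 : ContinuousWithinAt (bext g) (Ioi 0 ×ˢ Ico 0 c) (R, 0) := hg _ hp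
  -- restrict along the vertical segment `θ ↦ (R, θ)`, `θ ∈ (0, c)`
  have hline : Tendsto (fun θ : ℝ => ((R, θ) : ℝ × ℝ)) (𝓝[>] 0) (𝓝[Ioi 0 ×ˢ Ico 0 c] (R, 0)) := by
    refine tendsto_nhdsWithin_iff.2 ⟨?_, ?_⟩
    · exact ((continuous_const.prodMk continuous_id).tendsto' 0 (R, 0) rfl).mono_left nhdsWithin_le_nhds
    · filter_upwards [Ioo_mem_nhdsGT hc] with θ hθ
      exact ⟨hR, hθ.1.le, hθ.2⟩
  have h2 := h1.tendsto.comp hline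
  refine h2.congr' ?_
  filter_upwards [self_mem_nhdsWithin] with θ hθ
  exact bext_of_pos g (p := (R, θ)) hθ

/-- The limit value equals the extension's boundary value. [folklore] -/
theorem ExtZero.limUnder_eq (hc : 0 < c) {g : ℝ → ℝ → ℝ} (hg : ExtZero c g) {R : ℝ} (hR : 0 < R) {L : ℝ}
    (hL : Tendsto (fun θ => g R θ) (𝓝[>] 0) (𝓝 L)) : bext g (R, 0) = L :=
  tendsto_nhds_unique (hg.tendsto hc hR) hL

/-- **Criterion**: if `g` extended by SOME boundary function `g₀` is jointly continuous on the slab,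
then `ExtZero c g` (the boundary function must be the limit). [folklore] -/
theorem extZero_of_continuousOn (hc : 0 < c) {g : ℝ → ℝ → ℝ} {g₀ : ℝ → ℝ}
    (h : ContinuousOn (fun p : ℝ × ℝ => if p.2 ≤ 0 then g₀ p.1 else g p.1 p.2) (Ioi 0 ×ˢ Ico 0 c)) : ExtZero c g := by
  -- the limit along `θ → 0⁺` is `g₀ R`
  have hlim : ∀ R, 0 < R → limUnder (𝓝[>] (0:ℝ)) (fun θ => g R θ) = g₀ R := by
    intro R hR
    have hp : ((R, (0:ℝ)) : ℝ × ℝ) ∈ Ioi 0 ×ˢ Ico 0 c := ⟨hR, left_mem_Ico.2 hc⟩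
    have h1 := (h _ hp).tendsto
    have hline : Tendsto (fun θ : ℝ => ((R, θ) : ℝ × ℝ)) (𝓝[>] 0) (𝓝[Ioi 0 ×ˢ Ico 0 c] (R, 0)) := by
      refine tendsto_nhdsWithin_iff.2 ⟨?_, ?_⟩
      · exact ((continuous_const.prodMk continuous_id).tendsto' 0 (R, 0) rfl).mono_left nhdsWithin_le_nhds
      · filter_upwards [Ioo_mem_nhdsGT hc] with θ hθ
        exact ⟨hR, hθ.1.le, hθ.2⟩
    have h2 := h1.comp hline
    simp only [le_refl, if_true] at h2
    have h3 : Tendsto (fun θ => g R θ) (𝓝[>] 0) (𝓝 (g₀ R)) := by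
      refine h2.congr' ?_
      filter_upwards [self_mem_nhdsWithin] with θ hθ
      simp only [Function.comp, not_le.2 (show (0:ℝ) < θ from hθ), if_false]
    exact h3.limUnder_eq
  refine h.congr fun p hp => ?_
  by_cases h0 : p.2 ≤ 0
  · have hz : p.2 = 0 := le_antisymm h0 hp.2.1
    simp only [bext, h0, if_true]
    have : p = (p.1, 0) := by ext <;> simp [hz]
    rw [show (fun θ => g p.1 θ) = fun θ => g (p.1, (0:ℝ)).1 θ from rfl, hlim p.1 hp.1]
  · simp only [bext, h0, if_false]

/-- **Locality**: the classes only see the values on the open strip (for `c ≤ π/2`). [folklore] -/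
theorem extZero_congr (hcπ : c ≤ π / 2) {g g' : ℝ → ℝ → ℝ} (hgg' : ∀ p ∈ strip, g p.1 p.2 = g' p.1 p.2) :
    ExtZero c g ↔ ExtZero c g' := by
  have hb : ∀ p ∈ Ioi (0:ℝ) ×ˢ Ico (0:ℝ) c, bext g p = bext g' p := by
    intro p hp
    by_cases h0 : p.2 ≤ 0
    · simp only [bext, h0, if_true]
      have hev : (fun θ => g p.1 θ) =ᶠ[𝓝[>] (0:ℝ)] fun θ => g' p.1 θ := by
        filter_upwards [Ioo_mem_nhdsGT (by positivity : (0:ℝ) < π / 2)] with θ hθ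
        exact hgg' (p.1, θ) ⟨hp.1, hθ⟩
      show lim ((𝓝[>] (0:ℝ)).map fun θ => g p.1 θ) = lim ((𝓝[>] (0:ℝ)).map fun θ => g' p.1 θ)
      rw [Filter.map_congr hev]
    · simp only [bext, h0, if_false]
      exact hgg' p ⟨hp.1, not_le.1 h0, hp.2.2.trans_le hcπ⟩
  exact ⟨fun h => h.congr fun p hp => (hb p hp).symm, fun h => h.congr fun p hp => hb p hp⟩

/-! ### Algebraic closure properties of `ExtZero` -/

/-- At a slab point with `θ ≤ 0` the extension is the value at `(R, 0)`. [folklore] -/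
theorem bext_eq_of_nonpos (g : ℝ → ℝ → ℝ) {p : ℝ × ℝ} (hp : p.2 ≤ 0) (hp' : 0 ≤ p.2) : bext g p = bext g (p.1, 0) := by
  have hz : p.2 = 0 := le_antisymm hp hp'
  have : p = (p.1, 0) := by ext <;> simp [hz]
  rw [← this]

/-- **Products with coefficients continuous on the slab stay in the class.** [folklore] -/
theorem ExtZero.coef_mul (hc : 0 < c) {μ g : ℝ → ℝ → ℝ} (hμ : ContinuousOn (uncurry μ) (Ioi 0 ×ˢ Ico 0 c))
    (hg : ExtZero c g) : ExtZero c (fun R θ => μ R θ * g R θ) := by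
  refine extZero_of_continuousOn hc (g₀ := fun R => μ R 0 * bext g (R, 0)) ?_
  have hprod : ContinuousOn (fun p : ℝ × ℝ => uncurry μ p * bext g p) (Ioi 0 ×ˢ Ico 0 c) := hμ.mul hg
  refine hprod.congr fun p hp => ?_
  by_cases h0 : p.2 ≤ 0
  · have hz : p.2 = 0 := le_antisymm h0 hp.2.1
    simp only [h0, if_true, uncurry]
    rw [bext_eq_of_nonpos g h0 hp.2.1]
    have : p = (p.1, 0) := by ext <;> simp [hz]
    conv_rhs => rw [this]
  · simp only [h0, if_false, uncurry, bext]

/-- **Sums stay in the class.** [folklore] -/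
theorem ExtZero.add (hc : 0 < c) {g g' : ℝ → ℝ → ℝ} (hg : ExtZero c g) (hg' : ExtZero c g') :
    ExtZero c (fun R θ => g R θ + g' R θ) := by
  refine extZero_of_continuousOn hc (g₀ := fun R => bext g (R, 0) + bext g' (R, 0)) ?_
  have hsum : ContinuousOn (fun p : ℝ × ℝ => bext g p + bext g' p) (Ioi 0 ×ˢ Ico 0 c) := ContinuousOn.add hg hg'
  refine hsum.congr fun p hp => ?_
  by_cases h0 : p.2 ≤ 0
  · simp only [h0, if_true]
    rw [bext_eq_of_nonpos g h0 hp.2.1, bext_eq_of_nonpos g' h0 hp.2.1]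
  · simp only [h0, if_false, bext]

/-- Constants (in `θ`) times members: scalar multiples. [folklore] -/
theorem ExtZero.const_mul (hc : 0 < c) {g : ℝ → ℝ → ℝ} (a : ℝ) (hg : ExtZero c g) : ExtZero c (fun R θ => a * g R θ) :=
  ExtZero.coef_mul hc (μ := fun _ _ => a) continuousOn_const hg

/-- Differences stay in the class. [folklore] -/
theorem ExtZero.sub (hc : 0 < c) {g g' : ℝ → ℝ → ℝ} (hg : ExtZero c g) (hg' : ExtZero c g') :
    ExtZero c (fun R θ => g R θ - g' R θ) := by
  have h := hg.add hc (hg'.const_mul hc (-1))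
  have e : (fun R θ => g R θ - g' R θ) = fun R θ => g R θ + -1 * g' R θ := by funext R θ; ring
  rw [e]; exact h

/-! ### Iterated `θ`-derivatives on the strip: locality, linearity, product rule -/

/-- Iterated `∂_θ` of a sum on the strip. [folklore] -/
theorem iterate_dθ_add_strip {g g' : ℝ → ℝ → ℝ} (hg : ContDiffOn ℝ ∞ (uncurry g) strip) (hg' : ContDiffOn ℝ ∞ (uncurry g') strip)
    (l : ℕ) : ∀ p ∈ strip, (dθ^[l] fun R θ => g R θ + g' R θ) p.1 p.2 = (dθ^[l] g) p.1 p.2 + (dθ^[l] g') p.1 p.2 := by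
  induction l generalizing g g' with
  | zero => intro p _; rfl
  | succ l ih =>
    intro p hp
    -- `∂_θ(g + g') = ∂_θg + ∂_θg'` on the strip
    have h1 : ∀ q ∈ strip, dθ (fun R θ => g R θ + g' R θ) q.1 q.2 = (fun R θ => dθ g R θ + dθ g' R θ) q.1 q.2 := by
      intro q hq
      have dg := (differentiableAt_of_contDiffOn_strip (contDiffOn_nat_of_infty hg 1) (by simp) hq)
      have dg' := (differentiableAt_of_contDiffOn_strip (contDiffOn_nat_of_infty hg' 1) (by simp) hq)
      have hemb : DifferentiableAt ℝ (fun θ' : ℝ => (q.1, θ')) q.2 := (differentiableAt_const q.1).prodMk differentiableAt_id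
      have hq' : (q.1, q.2) = q := rfl
      have sg : DifferentiableAt ℝ (fun θ' => g q.1 θ') q.2 := by
        have := (hq' ▸ dg).comp q.2 hemb; exact this
      have sg' : DifferentiableAt ℝ (fun θ' => g' q.1 θ') q.2 := by
        have := (hq' ▸ dg').comp q.2 hemb; exact this
      show deriv (fun θ' => g q.1 θ' + g' q.1 θ') q.2 = deriv (fun θ' => g q.1 θ') q.2 + deriv (fun θ' => g' q.1 θ') q.2
      exact deriv_add sg sg'
    rw [Function.iterate_succ_apply, Function.iterate_succ_apply, Function.iterate_succ_apply]
    rw [iterate_dθ_congr (g := fun R θ => dθ g R θ + dθ g' R θ) h1 l p hp]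
    exact ih (contDiffOn_dθ_strip hg) (contDiffOn_dθ_strip hg') p hp

/-- Iterated `∂_θ` of a scalar multiple on the strip. [folklore] -/
theorem iterate_dθ_const_mul_strip (a : ℝ) (g : ℝ → ℝ → ℝ) (l : ℕ) :
    ∀ p : ℝ × ℝ, (dθ^[l] fun R θ => a * g R θ) p.1 p.2 = a * (dθ^[l] g) p.1 p.2 := by
  induction l generalizing g with
  | zero => intro p; rfl
  | succ l ih =>
    intro p
    have h1 : dθ (fun R θ => a * g R θ) = fun R θ => a * dθ g R θ := by
      funext R θ; show deriv (fun θ' => a * g R θ') θ = a * deriv (fun θ' => g R θ') θ; exact deriv_const_mul_field a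
    rw [Function.iterate_succ_apply, Function.iterate_succ_apply, h1]
    exact ih (dθ g) p

/-- `∂_θ(μg) = ∂_θμ·g + μ·∂_θg` on the strip. [folklore] -/
theorem dθ_mul_strip {μ g : ℝ → ℝ → ℝ} (hμ : ContDiffOn ℝ ∞ (uncurry μ) strip) (hg : ContDiffOn ℝ ∞ (uncurry g) strip) :
    ∀ p ∈ strip, dθ (fun R θ => μ R θ * g R θ) p.1 p.2 = dθ μ p.1 p.2 * g p.1 p.2 + μ p.1 p.2 * dθ g p.1 p.2 := by
  intro q hq
  have dμ := (differentiableAt_of_contDiffOn_strip (contDiffOn_nat_of_infty hμ 1) (by simp) hq)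
  have dg := (differentiableAt_of_contDiffOn_strip (contDiffOn_nat_of_infty hg 1) (by simp) hq)
  have hemb : DifferentiableAt ℝ (fun θ' : ℝ => (q.1, θ')) q.2 := (differentiableAt_const q.1).prodMk differentiableAt_id
  have hq' : (q.1, q.2) = q := rfl
  have sμ : DifferentiableAt ℝ (fun θ' => μ q.1 θ') q.2 := by
    have := (hq' ▸ dμ).comp q.2 hemb; exact this
  have sg : DifferentiableAt ℝ (fun θ' => g q.1 θ') q.2 := by
    have := (hq' ▸ dg).comp q.2 hemb; exact this
  show deriv (fun θ' => μ q.1 θ' * g q.1 θ') q.2 = deriv (fun θ' => μ q.1 θ') q.2 * g q.1 q.2 + μ q.1 q.2 * deriv (fun θ' => g q.1 θ') q.2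
  exact deriv_mul sμ sg

/-- Products of `C^∞(strip)` functions are `C^∞(strip)`. [folklore] -/
theorem contDiffOn_mul_strip {μ g : ℝ → ℝ → ℝ} (hμ : ContDiffOn ℝ ∞ (uncurry μ) strip) (hg : ContDiffOn ℝ ∞ (uncurry g) strip) :
    ContDiffOn ℝ ∞ (uncurry fun R θ => μ R θ * g R θ) strip := by
  have e : uncurry (fun R θ => μ R θ * g R θ) = fun p => uncurry μ p * uncurry g p := by funext p; rfl
  rw [e]; exact hμ.mul hg

/-- Sums of `C^∞(strip)` functions are `C^∞(strip)`. [folklore] -/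
theorem contDiffOn_add_strip {g g' : ℝ → ℝ → ℝ} (hg : ContDiffOn ℝ ∞ (uncurry g) strip) (hg' : ContDiffOn ℝ ∞ (uncurry g') strip) :
    ContDiffOn ℝ ∞ (uncurry fun R θ => g R θ + g' R θ) strip := by
  have e : uncurry (fun R θ => g R θ + g' R θ) = fun p => uncurry g p + uncurry g' p := by funext p; rfl
  rw [e]; exact hg.add hg'

/-! ### Closure properties of `ExtZeroUpTo` -/

/-- Monotonicity in the order. [folklore] -/
theorem ExtZeroUpTo.of_le {m m' : ℕ} {g : ℝ → ℝ → ℝ} (h : ExtZeroUpTo c m g) (hmm' : m' ≤ m) : ExtZeroUpTo c m' g :=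
  fun l hl => h l (hl.trans hmm')

/-- Order zero. [folklore] -/
theorem ExtZeroUpTo.zero {m : ℕ} {g : ℝ → ℝ → ℝ} (h : ExtZeroUpTo c m g) : ExtZero c g := h 0 (Nat.zero_le _)

/-- **The successor characterisation**: `ExtZeroUpTo c (m+1) g ↔ ExtZero c g ∧ ExtZeroUpTo c m (∂_θg)`. [folklore] -/
theorem extZeroUpTo_succ_iff {m : ℕ} {g : ℝ → ℝ → ℝ} : ExtZeroUpTo c (m + 1) g ↔ ExtZero c g ∧ ExtZeroUpTo c m (dθ g) := by
  constructor
  · intro h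
    refine ⟨h 0 (Nat.zero_le _), fun l hl => ?_⟩
    have := h (l + 1) (by omega)
    rwa [Function.iterate_succ_apply] at this
  · rintro ⟨h0, h1⟩ l hl
    rcases l with _ | l
    · exact h0
    · rw [Function.iterate_succ_apply]; exact h1 l (by omega)

/-- Locality of the classes. [folklore] -/
theorem extZeroUpTo_congr (hcπ : c ≤ π / 2) {m : ℕ} {g g' : ℝ → ℝ → ℝ} (hgg' : ∀ p ∈ strip, g p.1 p.2 = g' p.1 p.2) :
    ExtZeroUpTo c m g ↔ ExtZeroUpTo c m g' :=
  forall₂_congr fun l _ => extZero_congr hcπ (iterate_dθ_congr hgg' l)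

/-- **Sums.** [folklore] -/
theorem ExtZeroUpTo.add (hc : 0 < c) (hcπ : c ≤ π / 2) {m : ℕ} {g g' : ℝ → ℝ → ℝ} (hg : ContDiffOn ℝ ∞ (uncurry g) strip)
    (hg' : ContDiffOn ℝ ∞ (uncurry g') strip) (h : ExtZeroUpTo c m g) (h' : ExtZeroUpTo c m g') :
    ExtZeroUpTo c m (fun R θ => g R θ + g' R θ) := fun l hl =>
  (extZero_congr hcπ (iterate_dθ_add_strip hg hg' l)).2 ((h l hl).add hc (h' l hl))

/-- **Scalar multiples.** [folklore] -/
theorem ExtZeroUpTo.const_mul (hc : 0 < c) {m : ℕ} {g : ℝ → ℝ → ℝ} (a : ℝ) (h : ExtZeroUpTo c m g) :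
    ExtZeroUpTo c m (fun R θ => a * g R θ) := fun l hl => by
  have e : (dθ^[l] fun R θ => a * g R θ) = fun R θ => a * (dθ^[l] g) R θ := by
    funext R θ; exact iterate_dθ_const_mul_strip a g l (R, θ)
  rw [show ExtZero c (dθ^[l] fun R θ => a * g R θ) ↔ ExtZero c (fun R θ => a * (dθ^[l] g) R θ) by rw [e]]
  exact (h l hl).const_mul hc a

/-- **Differences.** [folklore] -/
theorem ExtZeroUpTo.sub (hc : 0 < c) (hcπ : c ≤ π / 2) {m : ℕ} {g g' : ℝ → ℝ → ℝ} (hg : ContDiffOn ℝ ∞ (uncurry g) strip)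
    (hg' : ContDiffOn ℝ ∞ (uncurry g') strip) (h : ExtZeroUpTo c m g) (h' : ExtZeroUpTo c m g') :
    ExtZeroUpTo c m (fun R θ => g R θ - g' R θ) := by
  have h2 := h.add hc hcπ hg (by
    have e : uncurry (fun R θ => -1 * g' R θ) = fun p => -1 * uncurry g' p := by funext p; rfl
    rw [e]; exact contDiffOn_const.mul hg') (h'.const_mul hc (-1))
  have e : (fun R θ => g R θ - g' R θ) = fun R θ => g R θ + -1 * g' R θ := by funext R θ; ring
  rw [e]; exact h2

/-- **Coefficients**: functions all of whose `θ`-derivatives are continuous on the slab and which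
are `C^∞` on the strip. [folklore] -/
def IsCoef (c : ℝ) (μ : ℝ → ℝ → ℝ) : Prop :=
  (∀ l : ℕ, ContinuousOn (uncurry (dθ^[l] μ)) (Ioi 0 ×ˢ Ico 0 c)) ∧ ContDiffOn ℝ ∞ (uncurry μ) strip

/-- `∂_θ` of a coefficient is a coefficient. [folklore] -/
theorem IsCoef.dθ {μ : ℝ → ℝ → ℝ} (h : IsCoef c μ) : IsCoef c (dθ μ) :=
  ⟨fun l => by rw [← Function.iterate_succ_apply]; exact h.1 (l + 1), contDiffOn_dθ_strip h.2⟩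

/-- **Products with coefficients.** [folklore] -/
theorem ExtZeroUpTo.coef_mul (hc : 0 < c) (hcπ : c ≤ π / 2) (m : ℕ) :
    ∀ {μ g : ℝ → ℝ → ℝ}, IsCoef c μ → ContDiffOn ℝ ∞ (uncurry g) strip → ExtZeroUpTo c m g →
      ExtZeroUpTo c m (fun R θ => μ R θ * g R θ) := by
  induction m with
  | zero =>
    intro μ g hμ _ hg l hl
    have hl0 : l = 0 := Nat.le_zero.1 hl
    subst hl0
    exact ExtZero.coef_mul hc ((hμ.1 0).congr fun p _ => rfl) hg.zero
  | succ m ih =>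
    intro μ g hμ hgs hg
    rw [extZeroUpTo_succ_iff] at hg ⊢
    refine ⟨ExtZero.coef_mul hc ((hμ.1 0).congr fun p _ => rfl) hg.1, ?_⟩
    -- `∂_θ(μg) = ∂_θμ·g + μ·∂_θg` on the strip
    rw [extZeroUpTo_congr hcπ (g' := fun R θ => dθ μ R θ * g R θ + μ R θ * dθ g R θ) (dθ_mul_strip hμ.2 hgs)]
    have hA := ih hμ.dθ hgs (hg.1 |> fun h0 => ?_)
    · have hB := ih hμ (contDiffOn_dθ_strip hgs) hg.2
      exact hA.add hc hcπ (contDiffOn_mul_strip hμ.dθ.2 hgs) (contDiffOn_mul_strip hμ.2 (contDiffOn_dθ_strip hgs)) hB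
    · -- `g ∈ ExtZeroUpTo c m` from `ExtZeroUpTo c (m+1)`
      exact (extZeroUpTo_succ_iff.2 ⟨h0, hg.2⟩).of_le (Nat.le_succ m)

end Elgindi

end Literature.Analysis.FluidPDE
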